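import Summits.CriticalPhenomena.PercolationContinuityZ3.Theorems.SahiMasterFamilyFCombRelCompressionDefs

/-!
# Relative down-compression inside an ambient set family — lemmas (support file for THEOREM S^rel / LEMMA I**)

Support file (prover seat `prim-bnk-2`, gen 31; `--supports stmt-CriticalPhenomena-4575`).  Memo:
`run/shared/lean/prim/prim-l12/FROM-prim-bnk-2-g31-COMPRESSION-THEOREM.md` §1.  Definitions in
`…SahiMasterFamilyFCombRelCompressionDefs`.

Cardinality and containment of (iterated) relative compressions; the split of an iterated relative compression
along a coordinate `c` (the `c`-free part of `D^Q_l 𝒢` is `D^{Q⁰}_{l'}(𝒢⁰ ∪ (𝒢¹ ∩ Q))`, the `c`-part is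
`D^{Q¹}_{l'}{K ∈ 𝒢¹ : K ∈ 𝒢 ∨ K ∉ Q}`, `Q⁰, Q¹, 𝒢⁰, 𝒢¹` the `c`-sections); heredity of convexity of the ambient.
No definitions; no `sorry`; standard axioms.
-/

namespace Summit.CriticalPhenomena.PercolationContinuityZ3.Theorems

namespace SahiFComb.Shift

open Finset FinsetFamily

variable {α : Type*} [DecidableEq α]

/-! ### 1. Size and containment -/

/-- The relative down-compression of a subfamily of the ambient family stays inside it. [this work] -/
theorem relCompression_subset {Q 𝒜 : Finset (Finset α)} {a : α} (h : 𝒜 ⊆ Q) :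
    relCompression Q a 𝒜 ⊆ Q := by
  intro s hs
  rcases mem_relCompression.1 hs with ⟨hs𝒜, -⟩ | ⟨-, -, hsQ⟩
  · exact h hs𝒜
  · exact hsQ

/-- Relative down-compression preserves the size of the family. [this work] -/
theorem card_relCompression (Q : Finset (Finset α)) (a : α) (𝒜 : Finset (Finset α)) :
    #(relCompression Q a 𝒜) = #𝒜 := by
  rw [relCompression, card_disjUnion, filter_image]
  have hinj : Set.InjOn (fun s : Finset α => s.erase a)
      (({s ∈ 𝒜 | ¬(s.erase a ∈ 𝒜 ∨ s.erase a ∉ Q)} : Finset (Finset α)) : Set (Finset α)) := by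
    refine (erase_injOn' a).mono fun s hs => ?_
    rw [mem_coe, mem_filter] at hs
    show a ∈ s
    by_contra has
    apply hs.2
    rw [erase_eq_of_notMem has]
    exact Or.inl hs.1
  have hfilt : ({s ∈ 𝒜 | (fun t => t ∉ 𝒜 ∧ t ∈ Q) (s.erase a)} : Finset (Finset α)) =
      {s ∈ 𝒜 | ¬(s.erase a ∈ 𝒜 ∨ s.erase a ∉ Q)} := by
    ext s; simp only [mem_filter, not_or, not_not]
  rw [hfilt, card_image_of_injOn hinj, ← card_union_of_disjoint (disjoint_filter_filter_not 𝒜 𝒜 _),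
    filter_union_filter_not_eq]

/-- Iterated relative down-compression preserves the size of the family. [this work] -/
theorem card_relDowns (Q : Finset (Finset α)) :
    ∀ (l : List α) (𝒳 : Finset (Finset α)), #(l.foldl (fun 𝒴 i => relCompression Q i 𝒴) 𝒳) = #𝒳
  | [], 𝒳 => rfl
  | _ :: l, 𝒳 => by rw [List.foldl_cons, card_relDowns Q l, card_relCompression]

/-- Iterated relative down-compression of a subfamily of the ambient family stays inside it. [this work] -/
theorem relDowns_subset (Q : Finset (Finset α)) :
    ∀ (l : List α) (𝒳 : Finset (Finset α)), 𝒳 ⊆ Q → l.foldl (fun 𝒴 i => relCompression Q i 𝒴) 𝒳 ⊆ Q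
  | [], _, h => h
  | _ :: l, _, h => relDowns_subset Q l _ (relCompression_subset h)

/-! ### 2. The split along a coordinate -/

/-- Relative compression along `i ≠ c` commutes with taking `c`-free parts (of the family and of the ambient). [this work] -/
theorem nonMemberSubfamily_relCompression {c i : α} (hic : i ≠ c) (Q 𝒳 : Finset (Finset α)) :
    (relCompression Q i 𝒳).nonMemberSubfamily c =
      relCompression (Q.nonMemberSubfamily c) i (𝒳.nonMemberSubfamily c) := by
  ext s
  simp only [mem_nonMemberSubfamily, mem_relCompression, mem_insert, mem_erase]
  constructor
  · rintro ⟨h | h, hc⟩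
    · refine Or.inl ⟨⟨h.1, hc⟩, ?_⟩
      rcases h.2 with h2 | h2
      · exact Or.inl ⟨h2, fun h' => hc h'.2⟩
      · exact Or.inr fun h' => h2 h'.1
    · refine Or.inr ⟨fun h' => h.1 h'.1, ⟨h.2.1, ?_⟩, h.2.2, hc⟩
      rintro (rfl | h'); exact hic rfl; exact hc h'
  · rintro (⟨⟨h1, hc⟩, h2⟩ | ⟨h1, ⟨h2, -⟩, ⟨h3, hc⟩⟩)
    · refine ⟨Or.inl ⟨h1, ?_⟩, hc⟩
      rcases h2 with ⟨h2, -⟩ | h2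
      · exact Or.inl h2
      · exact Or.inr fun h' => h2 ⟨h', fun h'' => hc h''.2⟩
    · exact ⟨Or.inr ⟨fun h => h1 ⟨h, hc⟩, h2, h3⟩, hc⟩

/-- Relative compression along `i ≠ c` commutes with taking `c`-parts (with `c` erased). [this work] -/
theorem memberSubfamily_relCompression {c i : α} (hic : i ≠ c) (Q 𝒳 : Finset (Finset α)) :
    (relCompression Q i 𝒳).memberSubfamily c =
      relCompression (Q.memberSubfamily c) i (𝒳.memberSubfamily c) := by
  ext s
  simp only [mem_memberSubfamily, mem_relCompression, mem_insert]
  have e1 : (insert c s).erase i = insert c (s.erase i) := erase_insert_of_ne hic.symm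
  have e2 : insert i (insert c s) = insert c (insert i s) := Finset.insert_comm i c s
  rw [e1, e2]
  constructor
  · rintro ⟨h | h, hc⟩
    · refine Or.inl ⟨⟨h.1, hc⟩, ?_⟩
      rcases h.2 with h2 | h2
      · exact Or.inl ⟨h2, fun h' => hc (mem_of_mem_erase h')⟩
      · exact Or.inr fun h' => h2 h'.1
    · refine Or.inr ⟨fun h' => h.1 h'.1, ⟨h.2.1, ?_⟩, h.2.2, hc⟩
      rintro (rfl | h'); exact hic rfl; exact hc h'
  · rintro (⟨⟨h1, hc⟩, h2⟩ | ⟨h1, ⟨h2, -⟩, ⟨h3, hc⟩⟩)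
    · refine ⟨Or.inl ⟨h1, ?_⟩, hc⟩
      rcases h2 with ⟨h2, -⟩ | h2
      · exact Or.inl h2
      · exact Or.inr fun h' => h2 ⟨h', fun h'' => hc (mem_of_mem_erase h'')⟩
    · exact ⟨Or.inr ⟨fun h => h1 ⟨h, hc⟩, h2, h3⟩, hc⟩

/-- After relative compression along `c`, the `c`-free part is `𝒢⁰ ∪ (𝒢¹ ∩ Q)`. [this work] -/
theorem nonMemberSubfamily_relCompression_self (c : α) (Q 𝒢 : Finset (Finset α)) :
    (relCompression Q c 𝒢).nonMemberSubfamily c =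
      𝒢.nonMemberSubfamily c ∪ {s ∈ 𝒢.memberSubfamily c | s ∈ Q} := by
  ext s
  simp only [mem_nonMemberSubfamily, mem_relCompression, mem_union, mem_filter, mem_memberSubfamily]
  constructor
  · rintro ⟨h | h, hc⟩
    · exact Or.inl ⟨h.1, hc⟩
    · exact Or.inr ⟨⟨h.2.1, hc⟩, h.2.2⟩
  · rintro (⟨hs, hc⟩ | ⟨⟨hs, hc⟩, hQ⟩)
    · exact ⟨Or.inl ⟨hs, Or.inl (by rwa [erase_eq_of_notMem hc])⟩, hc⟩
    · by_cases h : s ∈ 𝒢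
      · exact ⟨Or.inl ⟨h, Or.inl (by rwa [erase_eq_of_notMem hc])⟩, hc⟩
      · exact ⟨Or.inr ⟨h, hs, hQ⟩, hc⟩

/-- After relative compression along `c`, the `c`-part (with `c` erased) is `{K ∈ 𝒢¹ : K ∈ 𝒢 ∨ K ∉ Q}`. [this work] -/
theorem memberSubfamily_relCompression_self (c : α) (Q 𝒢 : Finset (Finset α)) :
    (relCompression Q c 𝒢).memberSubfamily c = {s ∈ 𝒢.memberSubfamily c | s ∈ 𝒢 ∨ s ∉ Q} := by
  ext s
  simp only [mem_memberSubfamily, mem_relCompression, mem_filter]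
  constructor
  · rintro ⟨h | h, hc⟩
    · rw [erase_insert hc] at h
      exact ⟨⟨h.1, hc⟩, h.2⟩
    · rw [Finset.insert_idem] at h
      exact absurd h.2.1 h.1
  · rintro ⟨⟨h1, hc⟩, h2⟩
    exact ⟨Or.inl ⟨h1, by rwa [erase_insert hc]⟩, hc⟩

/-- Iterated relative compression along a list avoiding `c` commutes with the `c`-free part. [this work] -/
theorem nonMemberSubfamily_relDowns {c : α} :
    ∀ (l : List α), c ∉ l → ∀ Q 𝒳 : Finset (Finset α),
      (l.foldl (fun 𝒴 i => relCompression Q i 𝒴) 𝒳).nonMemberSubfamily c =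
        l.foldl (fun 𝒴 i => relCompression (Q.nonMemberSubfamily c) i 𝒴) (𝒳.nonMemberSubfamily c)
  | [], _, Q, 𝒳 => rfl
  | i :: l, h, Q, 𝒳 => by
    have hic : i ≠ c := by rintro rfl; exact h List.mem_cons_self
    rw [List.foldl_cons, List.foldl_cons, nonMemberSubfamily_relDowns l (fun h' => h (List.mem_cons_of_mem _ h')),
      nonMemberSubfamily_relCompression hic]

/-- Iterated relative compression along a list avoiding `c` commutes with the `c`-part. [this work] -/
theorem memberSubfamily_relDowns {c : α} :
    ∀ (l : List α), c ∉ l → ∀ Q 𝒳 : Finset (Finset α),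
      (l.foldl (fun 𝒴 i => relCompression Q i 𝒴) 𝒳).memberSubfamily c =
        l.foldl (fun 𝒴 i => relCompression (Q.memberSubfamily c) i 𝒴) (𝒳.memberSubfamily c)
  | [], _, Q, 𝒳 => rfl
  | i :: l, h, Q, 𝒳 => by
    have hic : i ≠ c := by rintro rfl; exact h List.mem_cons_self
    rw [List.foldl_cons, List.foldl_cons, memberSubfamily_relDowns l (fun h' => h (List.mem_cons_of_mem _ h')),
      memberSubfamily_relCompression hic]

/-- Convexity of the ambient family passes to its `c`-free part. [this work] -/
theorem convex_nonMemberSubfamily {Q : Finset (Finset α)}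
    (hQ : ∀ ⦃F G K : Finset α⦄, F ∈ Q → G ∈ Q → F ⊆ K → K ⊆ G → K ∈ Q) (c : α) :
    ∀ ⦃F G K : Finset α⦄, F ∈ Q.nonMemberSubfamily c → G ∈ Q.nonMemberSubfamily c → F ⊆ K → K ⊆ G →
      K ∈ Q.nonMemberSubfamily c := by
  intro F G K hF hG hFK hKG
  rw [mem_nonMemberSubfamily] at hF hG ⊢
  exact ⟨hQ hF.1 hG.1 hFK hKG, fun h => hG.2 (hKG h)⟩

/-- Convexity of the ambient family passes to its `c`-part. [this work] -/
theorem convex_memberSubfamily {Q : Finset (Finset α)}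
    (hQ : ∀ ⦃F G K : Finset α⦄, F ∈ Q → G ∈ Q → F ⊆ K → K ⊆ G → K ∈ Q) (c : α) :
    ∀ ⦃F G K : Finset α⦄, F ∈ Q.memberSubfamily c → G ∈ Q.memberSubfamily c → F ⊆ K → K ⊆ G →
      K ∈ Q.memberSubfamily c := by
  intro F G K hF hG hFK hKG
  rw [mem_memberSubfamily] at hF hG ⊢
  exact ⟨hQ hF.1 hG.1 (insert_subset_insert c hFK) (insert_subset_insert c hKG), fun h => hG.2 (hKG h)⟩

end SahiFComb.Shift

end Summit.CriticalPhenomena.PercolationContinuityZ3.Theorems
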